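import Mathlib.Analysis.SpecialFunctions.Trigonometric.Basic
import Mathlib.Analysis.SpecialFunctions.Pow.Real
import Mathlib.NumberTheory.Real.GoldenRatio
import Mathlib.Algebra.Order.Floor.Defs
import HarnessLib

/-!
# Dyadic thresholds at golden-ratio points, decided by integer polynomial inequalities

Topic `Literature/Computability/QuantumComplexity`; a step in the discharge of
`ajl_jonesApproxProblem_mem_PromiseBQP` (`JonesInBQP.lean`). The block encodings of the Aharonov–Jones–
Landau gates (`HadamardSandwich.lean`) have entries `(1 − 2n/2^k)/2` where `n` counts the values
`a < 2^k` of an averaging register on which a sign is flipped; to hit the golden-ratio entries `1/φ`,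
`±1/√φ` of the local rotations (`JonesLocalGate.lean`) and the phase `e^{±3πi/5} = cos(3π/5) ± i sin(3π/5)`
one needs `n ≈ 2^k τ` for
`τ ∈ {(3−√5)/4, (1−1/√φ)/2, (1+1/√φ)/2, (3+√5)/8, (4−√(10+2√5))/8}` (`1 − 2τ = 1/φ, 1/√φ, −1/√φ,
cos(3π/5)·(−1)…`, see `one_sub_two_mul_tau*`). The circuit decides membership `a < 2^k τ` by a
**subtraction-free integer polynomial inequality** in `a` and `2^k` (degree `≤ 4`: the radicals are
removed by isolating and squaring); this file proves the five equivalences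

* `thr1_iff` : `4a < 3·2^k ∧ 6·2^k a < 4^k + 4a²            ↔ a < 2^k (3−√5)/4`,
* `thr2_iff` : `2a < 2^k ∧ P² + Q² > 5·16^k + 2PQ             ↔ a < 2^k (1−1/√φ)/2`
  (`P = 3·4^k + 8a²`, `Q = 8·2^k a`),
* `thr3_iff` : `2a < 2^k ∨ P'² + Q'² + 4^k P' < 16^k + 2P'Q' + 4^k Q' ↔ a < 2^k (1+1/√φ)/2`
  (`P' = 4a² + 4^k`, `Q' = 4·2^k a`),
* `thr4_iff` : `8a < 3·2^k ∨ 16a² + 4^k < 12·2^k a            ↔ a < 2^k (3+√5)/8`,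
* `thr5_iff` : `2b < 2^k ∧ P'' > Q'' ∧ P''² + Q''² > 20·16^k + 2P''Q'' ↔ b < 2^k (4−√(10+2√5))/8`
  (`P'' = 6·4^k + 64b²`, `Q'' = 64·2^k b`),

(and `thr0_iff`, `thr6_iff` for `τ₀ = 1/2`, `τ₆ = (1+√5)/4 = (1 + 1/φ)/2`, the entries `0` and
`−1/φ`), the counting lemma `card_filter_lt_real` (`|#{a < 2^k : a < 2^k τ} − 2^k τ| ≤ 1` for `0 ≤ τ ≤ 1`),
and the closed forms `cos(3π/5) = (1−√5)/4`, `sin(3π/5) = √(10+2√5)/4` (`Real.cos_pi_div_five` of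
Mathlib and double-angle formulas).

## References

* D. Aharonov, V. Jones, Z. Landau, Algorithmica 55 (2009) = arXiv:quant-ph/0511096, §2.12
  (`λ_ℓ = sin(πℓ/k)`, `d = 2cos(π/5) = φ`) [AharonovJonesLandau2009].
-/

noncomputable section

namespace Literature.Computability.QuantumComplexity

open Real

/-! ### Square-root bookkeeping -/

/-- `(√5)² = 5`. [folklore] -/
theorem sqrt_five_sq : Real.sqrt 5 ^ 2 = 5 := Real.sq_sqrt (by norm_num)

/-- `2 < √5 < 3`. [folklore] -/
theorem sqrt_five_bounds : 2 < Real.sqrt 5 ∧ Real.sqrt 5 < 3 := by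
  constructor
  · rw [show (2 : ℝ) = Real.sqrt 4 by rw [show (4 : ℝ) = 2 ^ 2 by norm_num, Real.sqrt_sq (by norm_num)]]
    exact Real.sqrt_lt_sqrt (by norm_num) (by norm_num)
  · rw [show (3 : ℝ) = Real.sqrt 9 by rw [show (9 : ℝ) = 3 ^ 2 by norm_num, Real.sqrt_sq (by norm_num)]]
    exact Real.sqrt_lt_sqrt (by norm_num) (by norm_num)

/-- `1/√φ`, squared, is `1/φ = φ − 1 = (√5 − 1)/2`. [folklore] -/
theorem inv_sqrt_goldenRatio_sq : (1 / Real.sqrt goldenRatio) ^ 2 = (Real.sqrt 5 - 1) / 2 := by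
  rw [div_pow, one_pow, Real.sq_sqrt goldenRatio_pos.le, ← inv_eq_one_div, inv_goldenRatio, goldenConj]
  ring

/-- `0 < 1/√φ < 1`. [folklore] -/
theorem inv_sqrt_goldenRatio_bounds : 0 < 1 / Real.sqrt goldenRatio ∧ 1 / Real.sqrt goldenRatio < 1 := by
  have h1 : 1 < Real.sqrt goldenRatio := by
    rw [show (1 : ℝ) = Real.sqrt 1 from Real.sqrt_one.symm]
    exact Real.sqrt_lt_sqrt (by norm_num) one_lt_goldenRatio
  exact ⟨by positivity, (div_lt_one (by linarith)).2 h1⟩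

/-! ### Counting below a real threshold -/

/-- **Counting the integers below a real threshold**: for `0 ≤ τ ≤ 1`, the number of `a < 2^k` with
`a < 2^k τ` is within `1` of `2^k τ` (it is `⌈2^k τ⌉`). [folklore] -/
theorem card_filter_lt_real (k : ℕ) {τ : ℝ} (h0 : 0 ≤ τ) (h1 : τ ≤ 1) :
    |(((Finset.range (2 ^ k)).filter fun a : ℕ => (a : ℝ) < 2 ^ k * τ).card : ℝ) - 2 ^ k * τ| ≤ 1 := by
  set x : ℝ := 2 ^ k * τ with hx
  have hx0 : 0 ≤ x := by positivity
  have hxle : x ≤ 2 ^ k := by rw [hx]; nlinarith [pow_pos (show (0:ℝ) < 2 by norm_num) k]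
  have hfilter : ((Finset.range (2 ^ k)).filter fun a : ℕ => (a : ℝ) < x) = Finset.range ⌈x⌉₊ := by
    ext a
    simp only [Finset.mem_filter, Finset.mem_range, Nat.lt_ceil]
    constructor
    · exact fun h => h.2
    · intro h
      refine ⟨?_, h⟩
      have : (a : ℝ) < 2 ^ k := lt_of_lt_of_le h hxle
      exact_mod_cast this
  rw [hfilter, Finset.card_range]
  have h2 := Nat.ceil_lt_add_one hx0
  have h3 := Nat.le_ceil x
  rw [abs_le]; constructor <;> linarith

/-! ### The five thresholds -/

section Thresholds

variable (k a : ℕ)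

/-- **Threshold 1** (`τ₁ = (3 − √5)/4 = 1/(2φ²)`, for the entry `1/φ`):
`4a < 3·2^k ∧ 6·2^k·a < 4^k + 4a²  ↔  a < 2^k τ₁`. [folklore] -/
theorem thr1_iff : (4 * a < 3 * 2 ^ k ∧ 6 * 2 ^ k * a < 4 ^ k + 4 * a ^ 2) ↔ (a : ℝ) < 2 ^ k * ((3 - Real.sqrt 5) / 4) := by
  obtain ⟨s2, s3⟩ := sqrt_five_bounds
  have s5 := sqrt_five_sq
  have hN : (0 : ℝ) < 2 ^ k := by positivity
  have cast1 : 4 * a < 3 * 2 ^ k ↔ 4 * (a : ℝ) < 3 * 2 ^ k := by norm_cast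
  have cast2 : 6 * 2 ^ k * a < 4 ^ k + 4 * a ^ 2 ↔ 6 * 2 ^ k * (a : ℝ) < (2 ^ k) ^ 2 + 4 * (a : ℝ) ^ 2 := by
    rw [show (4 : ℕ) ^ k = (2 ^ k) ^ 2 by rw [← pow_mul, mul_comm, pow_mul]; norm_num]; norm_cast
  rw [cast1, cast2]
  set A : ℝ := (a : ℝ)
  set N : ℝ := 2 ^ k
  -- `4A² − 6NA + N² = 4 (A − r₁)(A − r₂)`, `r₁ = N(3−√5)/4 < 3N/4 < r₂ = N(3+√5)/4`
  have hfac : ∀ A : ℝ, N ^ 2 + 4 * A ^ 2 - 6 * N * A = 4 * (A - N * ((3 - Real.sqrt 5) / 4)) * (A - N * ((3 + Real.sqrt 5) / 4)) := by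
    intro A; ring_nf; rw [s5]; ring
  constructor
  · rintro ⟨h1, h2⟩
    have hpos : 0 < 4 * (A - N * ((3 - Real.sqrt 5) / 4)) * (A - N * ((3 + Real.sqrt 5) / 4)) := by rw [← hfac]; linarith
    have hneg : A - N * ((3 + Real.sqrt 5) / 4) < 0 := by nlinarith
    by_contra hc
    push Not at hc
    have : 0 ≤ A - N * ((3 - Real.sqrt 5) / 4) := by linarith
    nlinarith
  · intro h
    constructor
    · nlinarith
    · have e := hfac A
      have hlt1 : A - N * ((3 - Real.sqrt 5) / 4) < 0 := by linarith
      have hlt2 : A - N * ((3 + Real.sqrt 5) / 4) < 0 := by nlinarith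
      nlinarith [mul_pos_of_neg_of_neg hlt1 hlt2]

/-- **Threshold 4** (`τ₄ = (3 + √5)/8 = (1 − cos(3π/5))/2`):
`8a < 3·2^k ∨ 16a² + 4^k < 12·2^k·a  ↔  a < 2^k τ₄`. [folklore] -/
theorem thr4_iff : (8 * a < 3 * 2 ^ k ∨ 16 * a ^ 2 + 4 ^ k < 12 * 2 ^ k * a) ↔ (a : ℝ) < 2 ^ k * ((3 + Real.sqrt 5) / 8) := by
  obtain ⟨s2, s3⟩ := sqrt_five_bounds
  have s5 := sqrt_five_sq
  have hN : (0 : ℝ) < 2 ^ k := by positivity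
  have cast1 : 8 * a < 3 * 2 ^ k ↔ 8 * (a : ℝ) < 3 * 2 ^ k := by norm_cast
  have cast2 : 16 * a ^ 2 + 4 ^ k < 12 * 2 ^ k * a ↔ 16 * (a : ℝ) ^ 2 + (2 ^ k) ^ 2 < 12 * 2 ^ k * (a : ℝ) := by
    rw [show (4 : ℕ) ^ k = (2 ^ k) ^ 2 by rw [← pow_mul, mul_comm, pow_mul]; norm_num]; norm_cast
  rw [cast1, cast2]
  set A : ℝ := (a : ℝ)
  set N : ℝ := 2 ^ k
  have hfac : ∀ A : ℝ, 16 * A ^ 2 + N ^ 2 - 12 * N * A = 16 * (A - N * ((3 - Real.sqrt 5) / 8)) * (A - N * ((3 + Real.sqrt 5) / 8)) := by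
    intro A; ring_nf; rw [s5]; ring
  constructor
  · rintro (h | h)
    · nlinarith
    · have hneg : 16 * (A - N * ((3 - Real.sqrt 5) / 8)) * (A - N * ((3 + Real.sqrt 5) / 8)) < 0 := by rw [← hfac]; linarith
      by_contra hc
      push Not at hc
      have h1 : 0 ≤ A - N * ((3 + Real.sqrt 5) / 8) := by linarith
      have h2 : 0 ≤ A - N * ((3 - Real.sqrt 5) / 8) := by nlinarith
      nlinarith [mul_nonneg h2 h1]
  · intro h
    by_cases h1 : 8 * A < 3 * N
    · exact Or.inl h1
    · right
      push Not at h1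
      have e := hfac A
      have hgt : 0 < A - N * ((3 - Real.sqrt 5) / 8) := by nlinarith
      have hlt : A - N * ((3 + Real.sqrt 5) / 8) < 0 := by linarith
      nlinarith [mul_neg_of_pos_of_neg hgt hlt]

/-- **Threshold 2** (`τ₂ = (1 − 1/√φ)/2`, for the entry `1/√φ`): with `P = 3·4^k + 8a²`, `Q = 8·2^k a`
(`P − Q = 2(2^k − 2a)² + 4^k > 0`), `2a < 2^k ∧ P² + Q² > 5·16^k + 2PQ  ↔  a < 2^k τ₂`. [folklore] -/
theorem thr2_iff :
    (2 * a < 2 ^ k ∧ 5 * 16 ^ k + 2 * ((3 * 4 ^ k + 8 * a ^ 2) * (8 * 2 ^ k * a)) < (3 * 4 ^ k + 8 * a ^ 2) ^ 2 + (8 * 2 ^ k * a) ^ 2) ↔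
      (a : ℝ) < 2 ^ k * ((1 - 1 / Real.sqrt goldenRatio) / 2) := by
  obtain ⟨s2, s3⟩ := sqrt_five_bounds
  have s5 := sqrt_five_sq
  obtain ⟨g0, g1⟩ := inv_sqrt_goldenRatio_bounds
  have gsq := inv_sqrt_goldenRatio_sq
  set g : ℝ := 1 / Real.sqrt goldenRatio with hg
  have hN : (0 : ℝ) < 2 ^ k := by positivity
  have e4 : ((4 : ℕ) : ℝ) ^ k = ((2 : ℝ) ^ k) ^ 2 := by rw [← pow_mul, mul_comm, pow_mul]; norm_num
  have e16 : ((16 : ℕ) : ℝ) ^ k = ((2 : ℝ) ^ k) ^ 4 := by rw [← pow_mul, mul_comm, pow_mul]; norm_num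
  have cast1 : 2 * a < 2 ^ k ↔ 2 * (a : ℝ) < 2 ^ k := by norm_cast
  have cast2 : 5 * 16 ^ k + 2 * ((3 * 4 ^ k + 8 * a ^ 2) * (8 * 2 ^ k * a)) < (3 * 4 ^ k + 8 * a ^ 2) ^ 2 + (8 * 2 ^ k * a) ^ 2 ↔
      5 * ((2 : ℝ) ^ k) ^ 4 + 2 * ((3 * ((2 : ℝ) ^ k) ^ 2 + 8 * (a : ℝ) ^ 2) * (8 * 2 ^ k * (a : ℝ))) <
        (3 * ((2 : ℝ) ^ k) ^ 2 + 8 * (a : ℝ) ^ 2) ^ 2 + (8 * 2 ^ k * (a : ℝ)) ^ 2 := by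
    rw [← e4, ← e16]; norm_cast
  rw [cast1, cast2]
  set A : ℝ := (a : ℝ)
  set N : ℝ := 2 ^ k
  -- with `x = N − 2A`: `P − Q = 2x² + N²`, and the big inequality says `(P − Q)² > 5N⁴`
  have key : ∀ A : ℝ, (3 * N ^ 2 + 8 * A ^ 2) ^ 2 + (8 * N * A) ^ 2 - (5 * N ^ 4 + 2 * ((3 * N ^ 2 + 8 * A ^ 2) * (8 * N * A))) =
      (2 * (N - 2 * A) ^ 2 + N ^ 2) ^ 2 - 5 * N ^ 4 := by intro A; ring
  -- `(2x² + N²)² > 5N⁴ ↔ 2x² + N² > √5 N² ↔ x² > N²(√5−1)/2 = (N g)²`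
  have hthr : ∀ x : ℝ, 0 ≤ x → ((2 * x ^ 2 + N ^ 2) ^ 2 - 5 * N ^ 4 > 0 ↔ N * g < x) := by
    intro x hx
    have hNg : 0 ≤ N * g := by positivity
    constructor
    · intro h
      have h1 : Real.sqrt 5 * N ^ 2 < 2 * x ^ 2 + N ^ 2 := by
        by_contra hc; push Not at hc
        have : (2 * x ^ 2 + N ^ 2) ^ 2 ≤ (Real.sqrt 5 * N ^ 2) ^ 2 := pow_le_pow_left₀ (by positivity) hc 2
        nlinarith
      have h2 : (N * g) ^ 2 < x ^ 2 := by rw [mul_pow, gsq]; nlinarith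
      exact lt_of_pow_lt_pow_left₀ 2 hx h2
    · intro h
      have h2 : (N * g) ^ 2 < x ^ 2 := pow_lt_pow_left₀ h hNg (by norm_num)
      rw [mul_pow, gsq] at h2
      have h1 : Real.sqrt 5 * N ^ 2 < 2 * x ^ 2 + N ^ 2 := by nlinarith
      nlinarith [pow_lt_pow_left₀ h1 (by positivity : 0 ≤ Real.sqrt 5 * N ^ 2) (by norm_num : (2:ℕ) ≠ 0)]
  constructor
  · rintro ⟨h1, h2⟩
    have hx : 0 ≤ N - 2 * A := by linarith
    have := (hthr (N - 2 * A) hx).1 (by rw [← key]; linarith)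
    nlinarith
  · intro h
    have h1 : 2 * A < N := by nlinarith
    refine ⟨h1, ?_⟩
    have hx : 0 ≤ N - 2 * A := by linarith
    have := (hthr (N - 2 * A) hx).2 (by nlinarith)
    have e := key A
    linarith

/-- **Threshold 3** (`τ₃ = (1 + 1/√φ)/2`, for the entry `−1/√φ`): with `P' = 4a² + 4^k`, `Q' = 4·2^k a`
(`P' − Q' = (2a − 2^k)²`), `2a < 2^k ∨ P'² + Q'² + 4^k P' < 16^k + 2P'Q' + 4^k Q'  ↔  a < 2^k τ₃`. [folklore] -/
theorem thr3_iff :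
    (2 * a < 2 ^ k ∨ (4 * a ^ 2 + 4 ^ k) ^ 2 + (4 * 2 ^ k * a) ^ 2 + 4 ^ k * (4 * a ^ 2 + 4 ^ k) <
        16 ^ k + 2 * ((4 * a ^ 2 + 4 ^ k) * (4 * 2 ^ k * a)) + 4 ^ k * (4 * 2 ^ k * a)) ↔
      (a : ℝ) < 2 ^ k * ((1 + 1 / Real.sqrt goldenRatio) / 2) := by
  obtain ⟨s2, s3⟩ := sqrt_five_bounds
  have s5 := sqrt_five_sq
  obtain ⟨g0, g1⟩ := inv_sqrt_goldenRatio_bounds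
  have gsq := inv_sqrt_goldenRatio_sq
  set g : ℝ := 1 / Real.sqrt goldenRatio with hg
  have hN : (0 : ℝ) < 2 ^ k := by positivity
  have e4 : ((4 : ℕ) : ℝ) ^ k = ((2 : ℝ) ^ k) ^ 2 := by rw [← pow_mul, mul_comm, pow_mul]; norm_num
  have e16 : ((16 : ℕ) : ℝ) ^ k = ((2 : ℝ) ^ k) ^ 4 := by rw [← pow_mul, mul_comm, pow_mul]; norm_num
  have cast1 : 2 * a < 2 ^ k ↔ 2 * (a : ℝ) < 2 ^ k := by norm_cast
  have cast2 : (4 * a ^ 2 + 4 ^ k) ^ 2 + (4 * 2 ^ k * a) ^ 2 + 4 ^ k * (4 * a ^ 2 + 4 ^ k) <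
        16 ^ k + 2 * ((4 * a ^ 2 + 4 ^ k) * (4 * 2 ^ k * a)) + 4 ^ k * (4 * 2 ^ k * a) ↔
      (4 * (a : ℝ) ^ 2 + ((2 : ℝ) ^ k) ^ 2) ^ 2 + (4 * 2 ^ k * (a : ℝ)) ^ 2 + ((2 : ℝ) ^ k) ^ 2 * (4 * (a : ℝ) ^ 2 + ((2 : ℝ) ^ k) ^ 2) <
        ((2 : ℝ) ^ k) ^ 4 + 2 * ((4 * (a : ℝ) ^ 2 + ((2 : ℝ) ^ k) ^ 2) * (4 * 2 ^ k * (a : ℝ))) + ((2 : ℝ) ^ k) ^ 2 * (4 * 2 ^ k * (a : ℝ)) := by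
    rw [← e4, ← e16]; norm_cast
  rw [cast1, cast2]
  set A : ℝ := (a : ℝ)
  set N : ℝ := 2 ^ k
  -- with `Y = (2A − N)²`: the big inequality says `Y² + N² Y < N⁴`, i.e. `Y < N²(√5−1)/2 = (N g)²`
  have key : ∀ A : ℝ, N ^ 4 + 2 * ((4 * A ^ 2 + N ^ 2) * (4 * N * A)) + N ^ 2 * (4 * N * A) -
      ((4 * A ^ 2 + N ^ 2) ^ 2 + (4 * N * A) ^ 2 + N ^ 2 * (4 * A ^ 2 + N ^ 2)) =
      N ^ 4 - ((2 * A - N) ^ 2) ^ 2 - N ^ 2 * (2 * A - N) ^ 2 := by intro A; ring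
  have hthr : ∀ y : ℝ, 0 ≤ y → (N ^ 4 - (y ^ 2) ^ 2 - N ^ 2 * y ^ 2 > 0 ↔ y < N * g) := by
    intro y hy
    have hNg : 0 ≤ N * g := by positivity
    -- `Y² + N²Y − N⁴ < 0 ↔ Y < N² (√5 − 1)/2` for `Y = y² ≥ 0` (roots `N²(−1 ± √5)/2`)
    have hfac : ∀ Y : ℝ, N ^ 4 - Y ^ 2 - N ^ 2 * Y = -((Y - N ^ 2 * ((Real.sqrt 5 - 1) / 2)) * (Y + N ^ 2 * ((Real.sqrt 5 + 1) / 2))) := by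
      intro Y; ring_nf; rw [s5]; ring
    constructor
    · intro h
      rw [hfac] at h
      have hpos : 0 < y ^ 2 + N ^ 2 * ((Real.sqrt 5 + 1) / 2) := by positivity
      have h1 : y ^ 2 - N ^ 2 * ((Real.sqrt 5 - 1) / 2) < 0 := by
        by_contra hc; push Not at hc; nlinarith [mul_nonneg hc hpos.le]
      have h2 : y ^ 2 < (N * g) ^ 2 := by rw [mul_pow, gsq]; linarith
      exact lt_of_pow_lt_pow_left₀ 2 hNg h2
    · intro h
      rw [hfac]
      have h2 : y ^ 2 < (N * g) ^ 2 := pow_lt_pow_left₀ h hy (by norm_num)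
      rw [mul_pow, gsq] at h2
      have h1 : y ^ 2 - N ^ 2 * ((Real.sqrt 5 - 1) / 2) < 0 := by linarith
      have hpos : 0 < y ^ 2 + N ^ 2 * ((Real.sqrt 5 + 1) / 2) := by positivity
      nlinarith [mul_neg_of_neg_of_pos h1 hpos]
  constructor
  · rintro (h | h)
    · nlinarith
    · by_cases hA : 2 * A < N
      · nlinarith
      · push Not at hA
        have := (hthr (2 * A - N) (by linarith)).1 (by rw [← key]; linarith)
        nlinarith
  · intro h
    by_cases hA : 2 * A < N
    · exact Or.inl hA
    · right
      push Not at hA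
      have := (hthr (2 * A - N) (by linarith)).2 (by nlinarith)
      have e := key A
      linarith

/-- **Threshold 5** (`τ₅ = (4 − √(10+2√5))/8 = (1 − sin(3π/5))/2`): with `P'' = 6·4^k + 64b²`,
`Q'' = 64·2^k b` (`P'' − Q'' = (4·2^k − 8b)² − 10·4^k`),
`2b < 2^k ∧ Q'' < P'' ∧ P''² + Q''² > 20·16^k + 2P''Q''  ↔  b < 2^k τ₅`. [folklore] -/
theorem thr5_iff :
    (2 * a < 2 ^ k ∧ 64 * 2 ^ k * a < 6 * 4 ^ k + 64 * a ^ 2 ∧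
        20 * 16 ^ k + 2 * ((6 * 4 ^ k + 64 * a ^ 2) * (64 * 2 ^ k * a)) < (6 * 4 ^ k + 64 * a ^ 2) ^ 2 + (64 * 2 ^ k * a) ^ 2) ↔
      (a : ℝ) < 2 ^ k * ((4 - Real.sqrt (10 + 2 * Real.sqrt 5)) / 8) := by
  obtain ⟨s2, s3⟩ := sqrt_five_bounds
  have s5 := sqrt_five_sq
  set r : ℝ := Real.sqrt (10 + 2 * Real.sqrt 5) with hr
  have hr0 : 0 ≤ r := Real.sqrt_nonneg _
  have hrsq : r ^ 2 = 10 + 2 * Real.sqrt 5 := Real.sq_sqrt (by positivity)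
  have hr4 : r < 4 := by
    rw [hr, Real.sqrt_lt' (by norm_num)]; nlinarith
  have hr3 : 3 < r := by
    rw [hr, Real.lt_sqrt (by norm_num)]; nlinarith
  have hN : (0 : ℝ) < 2 ^ k := by positivity
  have e4 : ((4 : ℕ) : ℝ) ^ k = ((2 : ℝ) ^ k) ^ 2 := by rw [← pow_mul, mul_comm, pow_mul]; norm_num
  have e16 : ((16 : ℕ) : ℝ) ^ k = ((2 : ℝ) ^ k) ^ 4 := by rw [← pow_mul, mul_comm, pow_mul]; norm_num
  have cast1 : 2 * a < 2 ^ k ↔ 2 * (a : ℝ) < 2 ^ k := by norm_cast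
  have cast2 : 64 * 2 ^ k * a < 6 * 4 ^ k + 64 * a ^ 2 ↔ 64 * 2 ^ k * (a : ℝ) < 6 * ((2 : ℝ) ^ k) ^ 2 + 64 * (a : ℝ) ^ 2 := by
    rw [← e4]; norm_cast
  have cast3 : 20 * 16 ^ k + 2 * ((6 * 4 ^ k + 64 * a ^ 2) * (64 * 2 ^ k * a)) < (6 * 4 ^ k + 64 * a ^ 2) ^ 2 + (64 * 2 ^ k * a) ^ 2 ↔
      20 * ((2 : ℝ) ^ k) ^ 4 + 2 * ((6 * ((2 : ℝ) ^ k) ^ 2 + 64 * (a : ℝ) ^ 2) * (64 * 2 ^ k * (a : ℝ))) <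
        (6 * ((2 : ℝ) ^ k) ^ 2 + 64 * (a : ℝ) ^ 2) ^ 2 + (64 * 2 ^ k * (a : ℝ)) ^ 2 := by
    rw [← e4, ← e16]; norm_cast
  rw [cast1, cast2, cast3]
  set A : ℝ := (a : ℝ)
  set N : ℝ := 2 ^ k
  -- with `x = 4N − 8A ≥ 0`: `P'' − Q'' = x² − 10N²`, and the conditions say `x² − 10N² > 2√5 N²`
  have key1 : ∀ A : ℝ, 6 * N ^ 2 + 64 * A ^ 2 - 64 * N * A = (4 * N - 8 * A) ^ 2 - 10 * N ^ 2 := by intro A; ring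
  have key2 : ∀ A : ℝ, (6 * N ^ 2 + 64 * A ^ 2) ^ 2 + (64 * N * A) ^ 2 - (20 * N ^ 4 + 2 * ((6 * N ^ 2 + 64 * A ^ 2) * (64 * N * A))) =
      ((4 * N - 8 * A) ^ 2 - 10 * N ^ 2) ^ 2 - 20 * N ^ 4 := by intro A; ring
  -- `D > 0 ∧ D² > 20N⁴ ↔ D > 2√5 N² ↔ x² > N²(10 + 2√5) = (N r)² ↔ x > N r`
  have hthr : ∀ x : ℝ, 0 ≤ x → ((0 < x ^ 2 - 10 * N ^ 2 ∧ 0 < (x ^ 2 - 10 * N ^ 2) ^ 2 - 20 * N ^ 4) ↔ N * r < x) := by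
    intro x hx
    have hNr : 0 ≤ N * r := by positivity
    constructor
    · rintro ⟨h1, h2⟩
      have h3 : 2 * Real.sqrt 5 * N ^ 2 < x ^ 2 - 10 * N ^ 2 := by
        by_contra hc; push Not at hc
        have := pow_le_pow_left₀ h1.le hc 2
        nlinarith
      have h4 : (N * r) ^ 2 < x ^ 2 := by rw [mul_pow, hrsq]; nlinarith
      exact lt_of_pow_lt_pow_left₀ 2 hx h4
    · intro h
      have h4 : (N * r) ^ 2 < x ^ 2 := pow_lt_pow_left₀ h hNr (by norm_num)
      rw [mul_pow, hrsq] at h4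
      have h3 : 2 * Real.sqrt 5 * N ^ 2 < x ^ 2 - 10 * N ^ 2 := by nlinarith
      have h1 : 0 < x ^ 2 - 10 * N ^ 2 := by nlinarith [Real.sqrt_nonneg 5]
      exact ⟨h1, by nlinarith [pow_lt_pow_left₀ h3 (by positivity : 0 ≤ 2 * Real.sqrt 5 * N ^ 2) (by norm_num : (2:ℕ) ≠ 0)]⟩
  constructor
  · rintro ⟨h1, h2, h3⟩
    have hx : 0 ≤ 4 * N - 8 * A := by linarith
    have := (hthr (4 * N - 8 * A) hx).1 ⟨by rw [← key1]; linarith, by rw [← key2]; linarith⟩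
    nlinarith
  · intro h
    have h1 : 2 * A < N := by nlinarith
    have hx : 0 ≤ 4 * N - 8 * A := by linarith
    obtain ⟨c1, c2⟩ := (hthr (4 * N - 8 * A) hx).2 (by nlinarith)
    refine ⟨h1, ?_, ?_⟩
    · have e := key1 A; linarith
    · have e := key2 A; linarith

end Thresholds

/-! ### The trigonometric values at `3π/5` -/

/-- `cos(3π/5) = (1 − √5)/4` (`= −1/(2φ)`). [folklore] -/
theorem cos_three_pi_div_five : Real.cos (3 * Real.pi / 5) = (1 - Real.sqrt 5) / 4 := by
  have h : 3 * Real.pi / 5 = Real.pi - 2 * (Real.pi / 5) := by ring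
  rw [h, Real.cos_pi_sub, Real.cos_two_mul, Real.cos_pi_div_five]
  have s5 := sqrt_five_sq
  nlinarith [s5]

/-- `sin(3π/5) = √(10 + 2√5)/4`. [folklore] -/
theorem sin_three_pi_div_five : Real.sin (3 * Real.pi / 5) = Real.sqrt (10 + 2 * Real.sqrt 5) / 4 := by
  have hpos : 0 < Real.sin (3 * Real.pi / 5) := Real.sin_pos_of_pos_of_lt_pi (by positivity) (by nlinarith [Real.pi_pos])
  have hsq : Real.sin (3 * Real.pi / 5) ^ 2 = (10 + 2 * Real.sqrt 5) / 16 := by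
    rw [Real.sin_sq, cos_three_pi_div_five]
    have s5 := sqrt_five_sq
    nlinarith [s5]
  have h16 : (10 + 2 * Real.sqrt 5) / 16 = (Real.sqrt (10 + 2 * Real.sqrt 5) / 4) ^ 2 := by
    rw [div_pow, Real.sq_sqrt (by positivity)]; norm_num
  rw [h16] at hsq
  exact (sq_eq_sq₀ hpos.le (by positivity)).1 hsq

/-! ### The threshold constants as block-encoding entries -/

/-- `1 − 2τ₁ = 1/φ` for `τ₁ = (3 − √5)/4`. [folklore] -/
theorem one_sub_two_mul_tau1 : 1 - 2 * ((3 - Real.sqrt 5) / 4) = goldenRatio⁻¹ := by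
  rw [inv_goldenRatio, goldenConj]; ring

/-- `1 − 2τ₂ = 1/√φ` for `τ₂ = (1 − 1/√φ)/2`. [folklore] -/
theorem one_sub_two_mul_tau2 : 1 - 2 * ((1 - 1 / Real.sqrt goldenRatio) / 2) = 1 / Real.sqrt goldenRatio := by ring

/-- `1 − 2τ₃ = −1/√φ` for `τ₃ = (1 + 1/√φ)/2`. [folklore] -/
theorem one_sub_two_mul_tau3 : 1 - 2 * ((1 + 1 / Real.sqrt goldenRatio) / 2) = -(1 / Real.sqrt goldenRatio) := by ring

/-- `1 − 2τ₄ = cos(3π/5)` for `τ₄ = (3 + √5)/8`. [folklore] -/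
theorem one_sub_two_mul_tau4 : 1 - 2 * ((3 + Real.sqrt 5) / 8) = Real.cos (3 * Real.pi / 5) := by
  rw [cos_three_pi_div_five]; ring

/-- `1 − 2τ₅ = sin(3π/5)` for `τ₅ = (4 − √(10 + 2√5))/8`. [folklore] -/
theorem one_sub_two_mul_tau5 : 1 - 2 * ((4 - Real.sqrt (10 + 2 * Real.sqrt 5)) / 8) = Real.sin (3 * Real.pi / 5) := by
  rw [sin_three_pi_div_five]; ring

/-- All five thresholds lie in `[0, 1]` (so `card_filter_lt_real` applies). [folklore] -/
theorem tau_mem_unitInterval :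
    (0 ≤ (3 - Real.sqrt 5) / 4 ∧ (3 - Real.sqrt 5) / 4 ≤ 1) ∧
    (0 ≤ (1 - 1 / Real.sqrt goldenRatio) / 2 ∧ (1 - 1 / Real.sqrt goldenRatio) / 2 ≤ 1) ∧
    (0 ≤ (1 + 1 / Real.sqrt goldenRatio) / 2 ∧ (1 + 1 / Real.sqrt goldenRatio) / 2 ≤ 1) ∧
    (0 ≤ (3 + Real.sqrt 5) / 8 ∧ (3 + Real.sqrt 5) / 8 ≤ 1) ∧
    (0 ≤ (4 - Real.sqrt (10 + 2 * Real.sqrt 5)) / 8 ∧ (4 - Real.sqrt (10 + 2 * Real.sqrt 5)) / 8 ≤ 1) := by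
  obtain ⟨s2, s3⟩ := sqrt_five_bounds
  obtain ⟨g0, g1⟩ := inv_sqrt_goldenRatio_bounds
  have hr4 : Real.sqrt (10 + 2 * Real.sqrt 5) < 4 := by
    rw [Real.sqrt_lt' (by norm_num)]; nlinarith
  have hr0 : 0 ≤ Real.sqrt (10 + 2 * Real.sqrt 5) := Real.sqrt_nonneg _
  refine ⟨⟨by linarith, by linarith⟩, ⟨by linarith, by linarith⟩, ⟨by linarith, by linarith⟩, ⟨by linarith, by linarith⟩,
    ⟨by linarith, by linarith⟩⟩

/-! ### Two more thresholds: `τ₀ = 1/2` (zero entries) and `τ₆ = (1+√5)/4` (the entry `−1/φ`) -/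

/-- **Threshold 0** (`τ₀ = 1/2`, for a vanishing entry): `2a < 2^k ↔ a < 2^k / 2`. [folklore] -/
theorem thr0_iff (k a : ℕ) : 2 * a < 2 ^ k ↔ (a : ℝ) < 2 ^ k * (1 / 2) := by
  have cast1 : 2 * a < 2 ^ k ↔ 2 * (a : ℝ) < 2 ^ k := by norm_cast
  rw [cast1]; constructor <;> intro h <;> linarith

/-- **Threshold 6** (`τ₆ = (1 + √5)/4 = (1 + 1/φ)/2`, for the entry `−1/φ`):
`4a < 2^k ∨ 16a² < 4·4^k + 8·2^k·a  ↔  a < 2^k τ₆`. [folklore] -/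
theorem thr6_iff (k a : ℕ) : (4 * a < 2 ^ k ∨ 16 * a ^ 2 < 4 * 4 ^ k + 8 * 2 ^ k * a) ↔ (a : ℝ) < 2 ^ k * ((1 + Real.sqrt 5) / 4) := by
  obtain ⟨s2, s3⟩ := sqrt_five_bounds
  have s5 := sqrt_five_sq
  have hN : (0 : ℝ) < 2 ^ k := by positivity
  have cast1 : 4 * a < 2 ^ k ↔ 4 * (a : ℝ) < 2 ^ k := by norm_cast
  have cast2 : 16 * a ^ 2 < 4 * 4 ^ k + 8 * 2 ^ k * a ↔ 16 * (a : ℝ) ^ 2 < 4 * ((2 : ℝ) ^ k) ^ 2 + 8 * 2 ^ k * (a : ℝ) := by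
    rw [show (4 : ℕ) ^ k = (2 ^ k) ^ 2 by rw [← pow_mul, mul_comm, pow_mul]; norm_num]; norm_cast
  rw [cast1, cast2]
  set A : ℝ := (a : ℝ)
  set N : ℝ := 2 ^ k
  -- `16A² − 8NA − 4N² = 16 (A − N(1+√5)/4)(A − N(1−√5)/4)`, second factor positive for `A ≥ 0`
  have hfac : ∀ A : ℝ, 16 * A ^ 2 - (4 * N ^ 2 + 8 * N * A) = 16 * (A - N * ((1 + Real.sqrt 5) / 4)) * (A - N * ((1 - Real.sqrt 5) / 4)) := by
    intro A; ring_nf; rw [s5]; ring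
  have hA0 : 0 ≤ A := Nat.cast_nonneg _
  have hpos2 : 0 < A - N * ((1 - Real.sqrt 5) / 4) := by nlinarith
  constructor
  · rintro (h | h)
    · nlinarith
    · have hneg : 16 * (A - N * ((1 + Real.sqrt 5) / 4)) * (A - N * ((1 - Real.sqrt 5) / 4)) < 0 := by rw [← hfac]; linarith
      by_contra hc
      push Not at hc
      have h1 : 0 ≤ A - N * ((1 + Real.sqrt 5) / 4) := by linarith
      nlinarith [mul_nonneg h1 hpos2.le]
  · intro h
    right
    have e := hfac A
    have hlt : A - N * ((1 + Real.sqrt 5) / 4) < 0 := by linarith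
    nlinarith [mul_neg_of_neg_of_pos hlt hpos2]

/-- `1 − 2τ₆ = −1/φ` for `τ₆ = (1 + √5)/4`. [folklore] -/
theorem one_sub_two_mul_tau6 : 1 - 2 * ((1 + Real.sqrt 5) / 4) = -goldenRatio⁻¹ := by
  rw [inv_goldenRatio, goldenConj]; ring

/-- `τ₀, τ₆ ∈ [0, 1]`. [folklore] -/
theorem tau06_mem_unitInterval :
    (0 ≤ (1 : ℝ) / 2 ∧ (1 : ℝ) / 2 ≤ 1) ∧ (0 ≤ (1 + Real.sqrt 5) / 4 ∧ (1 + Real.sqrt 5) / 4 ≤ 1) := by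
  obtain ⟨s2, s3⟩ := sqrt_five_bounds
  exact ⟨⟨by norm_num, by norm_num⟩, ⟨by positivity, by linarith⟩⟩

end Literature.Computability.QuantumComplexity

end
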